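import Summits.ValiantsHypothesis.ValiantsHypothesis.Theses.NumTame

/-!
# Birth skeleton — crux `TameNF` (item `stmt-ValiantsHypothesis-5385`), route `NumTame`, line `birth`

`TameNF` (cube-tame normal form): every fan-in-two `ℂ`-circuit `P` computing `f`
(`n` variables, coefficients of modulus `≤ 2^t`) can be replaced by a fan-in-two circuit
computing `f` of size `≤ N^c + c`, `N = |P| + n + t + deg f`, all of whose constants, sum
weights and gate values on `{0,1}ⁿ` have modulus `≤ 2^(N^c + c)`.

Line (three named stubs, composed by `TameNF_of`; every statement is in UNIFORM-BUDGET form —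
all input parameters `≤ N`, all output parameters `≤ N^c + c` — so that the composition is
p-bounded bookkeeping only):

* `stub_degreeNF` = `DegreeNF` — DEGREE NORMAL FORM (Strassen 1973 homogeneous components /
  Malod–Portier 2008 Lemma 2; Bürgisser 2000 §2; KNOWN in print, not in tree): a fan-in-two
  circuit computing `f` can be replaced by one of size `poly(|P|, deg f)` computing `f` whose gate
  FORMAL degrees (`ArithCircuit.gateFormalDegrees`: inputs, incl. constants, have formal degree 1)
  are `poly(|P|, deg f)`; constants stay ARBITRARY.  (Construction: homogeneous components
  `g^{(i)}`, `i ≤ deg f`, of every gate, the degree-0 components entering as sum WEIGHTS; size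
  `O(|P|·(deg f + 1)²)`, formal degrees `≤ max(deg f, 1)`.)
* `stub_smallConstants` = `SmallConstantsNF` — SMALL CONSTANTS AT BOUNDED FORMAL DEGREE (the OPEN
  core; the route's `MagnitudeNF` (stmt-5387) with the WLOG formal-degree hypothesis supplied by
  `stub_degreeNF` and with the refuters' loophole fix `∀ g ∈ P'.gates, 1 ≤ g.fanIn` — no empty
  product gate, hence no formal-degree-0 tower `2^(2^k)`, refuter evidence
  `NumTameTowerLoophole.lean` on stmt-5388): given formal degrees `≤ N`, coefficients `≤ 2^N`,
  `|P|, n, deg f ≤ N`, there is a circuit computing the SAME `f` with size and formal degrees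
  `≤ N^c + c`, every gate of fan-in 1 or 2, and all constants / sum weights / output constant of
  modulus `≤ 2^(N^c + c)`.
* `stub_growth` = `CubeGrowth` — GROWTH LEMMA (folklore forward bound, provable now; the corrected
  content of the route's `MagnitudeGlue`, stmt-5388): fan-in `∈ {1,2}`, constants and weights
  `≤ 2^R`, formal degrees `≤ D` ⇒ every gate value at a `0/1` point has modulus
  `≤ 2^((R+1)·D·(|P|+1))` (induction over the gate list: gate `j` is bounded by
  `2^((R+1)·fdeg_j·(j+2))`; fan-in `≥ 1` forces `fdeg_j ≥ 1`, which the sum case needs).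

`TameNF_of : Registered.stub_degreeNF → Registered.stub_smallConstants → Registered.stub_growth →
TameNF` is the real (sorry-free) composition: budget `N ↦ N₂ = N^c₁ + c₁ + N ↦ M = N₂^c₂ + c₂`,
growth with `R = D = M`, and the composite bound `(M+1)·M·(M+1) + M` is p-bounded
(`bound_isPBounded`, from `IsPBounded.add/mul/pow_holds`), whence ONE exponent `c` for the crux.
The `Registered.stub_…` aliases are the device of `Cruxes/RestorationQP/Lines/birth.lean`
(hypotheses of the composition admissible iff declared stubs BY NAME).
-/

namespace Summit.ValiantsHypothesis.ValiantsHypothesis.Cruxes.TameNF.Birth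

open Literature.Computability.AlgebraicComplexity
open Summit.ValiantsHypothesis.ValiantsHypothesis.Theses.NumTame (TameNF)

/-! ## The three stub statements -/

/-- DEGREE NORMAL FORM (uniform budget): if `|P| ≤ N` and `deg f ≤ N`, some fan-in-two circuit of
size `≤ N^c + c` computes the same `f` with all gate formal degrees `≤ N^c + c` (Strassen 1973;
Malod–Portier 2008, Lemma 2; Bürgisser 2000, §2). [known, not in tree; size L] -/
def DegreeNF : Prop :=
  ∃ c : ℕ, ∀ (n N : ℕ) (f : MvPolynomial (Fin n) ℂ) (P : ArithCircuit ℂ (Fin n)),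
    P.IsFanInTwo → P.Computes f → P.size ≤ N → f.totalDegree ≤ N →
    ∃ P' : ArithCircuit ℂ (Fin n), P'.Computes f ∧ P'.IsFanInTwo ∧ P'.size ≤ N ^ c + c ∧
      ∀ d ∈ ArithCircuit.gateFormalDegrees P'.gates, d ≤ N ^ c + c

/-- SMALL CONSTANTS AT BOUNDED FORMAL DEGREE (uniform budget; the open core of `TameNF`):
coefficients `≤ 2^N`, `|P|, n, deg f ≤ N`, gate formal degrees `≤ N` ⇒ a circuit computing the
same `f` with size and formal degrees `≤ N^c + c`, every gate of fan-in `≥ 1` (and `≤ 2`), and all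
constants, sum weights and output constant of modulus `≤ 2^(N^c + c)`
(Koiran–Perifel 2011 = arXiv:0710.0360, Rem. 4: open; Bürgisser 2000 TCS p. 73). [open; size XL] -/
def SmallConstantsNF : Prop :=
  ∃ c : ℕ, ∀ (n N : ℕ) (f : MvPolynomial (Fin n) ℂ) (P : ArithCircuit ℂ (Fin n)),
    (∀ m, ‖MvPolynomial.coeff m f‖ ≤ (2 : ℝ) ^ N) → P.IsFanInTwo → P.Computes f →
    P.size ≤ N → n ≤ N → f.totalDegree ≤ N →
    (∀ d ∈ ArithCircuit.gateFormalDegrees P.gates, d ≤ N) →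
    ∃ P' : ArithCircuit ℂ (Fin n), P'.Computes f ∧ P'.IsFanInTwo ∧ P'.size ≤ N ^ c + c ∧
      (∀ g ∈ P'.gates, 1 ≤ ArithCircuit.Gate.fanIn g) ∧
      (∀ d ∈ ArithCircuit.gateFormalDegrees P'.gates, d ≤ N ^ c + c) ∧
      (∀ g ∈ P'.gates, ∀ u ∈ ArithCircuit.Gate.args g, ∀ a : ℂ,
        u = ArithCircuit.Operand.const a → ‖a‖ ≤ (2 : ℝ) ^ (N ^ c + c)) ∧
      (∀ args, ArithCircuit.Gate.sum args ∈ P'.gates → ∀ a ∈ args,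
        ‖a.1‖ ≤ (2 : ℝ) ^ (N ^ c + c)) ∧
      (∀ a : ℂ, P'.output = ArithCircuit.Operand.const a → ‖a‖ ≤ (2 : ℝ) ^ (N ^ c + c))

/-- GROWTH LEMMA: every gate of fan-in 1 or 2, constants and sum weights of modulus `≤ 2^R`, all
gate formal degrees `≤ D` ⇒ every gate value at a `0/1` point has modulus `≤ 2^((R+1)·D·(|P|+1))`.
The fan-in `≥ 1` hypothesis is NECESSARY in the tree's model (empty product gate: value 1, formal
degree 0 ⇒ towers `2^(2^k)` at formal degree 0). [folklore; provable now; size M] -/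
def CubeGrowth : Prop :=
  ∀ (n : ℕ) (P : ArithCircuit ℂ (Fin n)) (R D : ℕ), P.IsFanInTwo →
    (∀ g ∈ P.gates, 1 ≤ ArithCircuit.Gate.fanIn g) →
    (∀ g ∈ P.gates, ∀ u ∈ ArithCircuit.Gate.args g, ∀ a : ℂ,
      u = ArithCircuit.Operand.const a → ‖a‖ ≤ (2 : ℝ) ^ R) →
    (∀ args, ArithCircuit.Gate.sum args ∈ P.gates → ∀ a ∈ args, ‖a.1‖ ≤ (2 : ℝ) ^ R) →
    (∀ d ∈ ArithCircuit.gateFormalDegrees P.gates, d ≤ D) →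
    ∀ g ∈ ArithCircuit.gateValues P.gates, ∀ x : Fin n → Bool,
      ‖MvPolynomial.eval (boolPoint ℂ x) g‖ ≤ (2 : ℝ) ^ ((R + 1) * D * (P.size + 1))

/-! ## Registered stubs (signatures = the statements above, verbatim) -/

/-- STUB `stub_degreeNF` (signature = `DegreeNF` verbatim): degree normal form by homogeneous
components. [known: Strassen 1973; Malod–Portier 2008 Lemma 2; Bürgisser 2000 §2 — size L] -/
theorem stub_degreeNF :
    ∃ c : ℕ, ∀ (n N : ℕ) (f : MvPolynomial (Fin n) ℂ) (P : ArithCircuit ℂ (Fin n)),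
      P.IsFanInTwo → P.Computes f → P.size ≤ N → f.totalDegree ≤ N →
      ∃ P' : ArithCircuit ℂ (Fin n), P'.Computes f ∧ P'.IsFanInTwo ∧ P'.size ≤ N ^ c + c ∧
        ∀ d ∈ ArithCircuit.gateFormalDegrees P'.gates, d ≤ N ^ c + c := by
  sorry

/-- STUB `stub_smallConstants` (signature = `SmallConstantsNF` verbatim): the open core — small
constants at bounded formal degree, exact computation of the same `f`, fan-in `∈ {1,2}`.
[open: Koiran–Perifel 2011 Rem. 4; Bürgisser 2000 TCS p. 73 — size XL] -/
theorem stub_smallConstants :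
    ∃ c : ℕ, ∀ (n N : ℕ) (f : MvPolynomial (Fin n) ℂ) (P : ArithCircuit ℂ (Fin n)),
      (∀ m, ‖MvPolynomial.coeff m f‖ ≤ (2 : ℝ) ^ N) → P.IsFanInTwo → P.Computes f →
      P.size ≤ N → n ≤ N → f.totalDegree ≤ N →
      (∀ d ∈ ArithCircuit.gateFormalDegrees P.gates, d ≤ N) →
      ∃ P' : ArithCircuit ℂ (Fin n), P'.Computes f ∧ P'.IsFanInTwo ∧ P'.size ≤ N ^ c + c ∧
        (∀ g ∈ P'.gates, 1 ≤ ArithCircuit.Gate.fanIn g) ∧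
        (∀ d ∈ ArithCircuit.gateFormalDegrees P'.gates, d ≤ N ^ c + c) ∧
        (∀ g ∈ P'.gates, ∀ u ∈ ArithCircuit.Gate.args g, ∀ a : ℂ,
          u = ArithCircuit.Operand.const a → ‖a‖ ≤ (2 : ℝ) ^ (N ^ c + c)) ∧
        (∀ args, ArithCircuit.Gate.sum args ∈ P'.gates → ∀ a ∈ args,
          ‖a.1‖ ≤ (2 : ℝ) ^ (N ^ c + c)) ∧
        (∀ a : ℂ, P'.output = ArithCircuit.Operand.const a → ‖a‖ ≤ (2 : ℝ) ^ (N ^ c + c)) := by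
  sorry

/-- STUB `stub_growth` (signature = `CubeGrowth` verbatim): the growth lemma on the Boolean cube.
[folklore; provable now by induction over the gate list — size M] -/
theorem stub_growth :
    ∀ (n : ℕ) (P : ArithCircuit ℂ (Fin n)) (R D : ℕ), P.IsFanInTwo →
      (∀ g ∈ P.gates, 1 ≤ ArithCircuit.Gate.fanIn g) →
      (∀ g ∈ P.gates, ∀ u ∈ ArithCircuit.Gate.args g, ∀ a : ℂ,
        u = ArithCircuit.Operand.const a → ‖a‖ ≤ (2 : ℝ) ^ R) →
      (∀ args, ArithCircuit.Gate.sum args ∈ P.gates → ∀ a ∈ args, ‖a.1‖ ≤ (2 : ℝ) ^ R) →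
      (∀ d ∈ ArithCircuit.gateFormalDegrees P.gates, d ≤ D) →
      ∀ g ∈ ArithCircuit.gateValues P.gates, ∀ x : Fin n → Bool,
        ‖MvPolynomial.eval (boolPoint ℂ x) g‖ ≤ (2 : ℝ) ^ ((R + 1) * D * (P.size + 1)) := by
  sorry

/-! ## Name-keyed aliases of the stub statements (hypotheses of the composition)

`Registered.stub_X` is the statement of `stub_X` under the registered stub's short name, so that
the native skeleton audit (hypotheses admissible iff registered obligations / declared stubs BY
NAME) accepts `TameNF_of : Registered.stub_… → … → TameNF`
(device of `Cruxes/RestorationQP/Lines/birth.lean`, `Cruxes/ClassTransfer/Lines/birth.lean`). -/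
namespace Registered

/-- Alias of `DegreeNF` (= the signature of `stub_degreeNF`). -/
abbrev stub_degreeNF : Prop := DegreeNF
/-- Alias of `SmallConstantsNF` (= the signature of `stub_smallConstants`). -/
abbrev stub_smallConstants : Prop := SmallConstantsNF
/-- Alias of `CubeGrowth` (= the signature of `stub_growth`). -/
abbrev stub_growth : Prop := CubeGrowth

end Registered

/-! ## Composition (kernel-checked, sorry-free) -/

/-- Bookkeeping for the composition (proved): the composite budget
`N ↦ (M+1)·M·(M+1) + M`, `M = (N^c₁ + c₁ + N)^c₂ + c₂`, is p-bounded. [folklore] -/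
theorem bound_isPBounded (c₁ c₂ : ℕ) :
    IsPBounded (fun N : ℕ =>
      ((N ^ c₁ + c₁ + N) ^ c₂ + c₂ + 1) * ((N ^ c₁ + c₁ + N) ^ c₂ + c₂) *
        ((N ^ c₁ + c₁ + N) ^ c₂ + c₂ + 1) + ((N ^ c₁ + c₁ + N) ^ c₂ + c₂)) := by
  have h1 : IsPBounded fun N : ℕ => N ^ c₁ + c₁ + N :=
    IsPBounded.add_holds
      (IsPBounded.add_holds (IsPBounded.pow_holds IsPBounded.id c₁) (IsPBounded.const c₁))
      IsPBounded.id
  have hm : IsPBounded fun N : ℕ => (N ^ c₁ + c₁ + N) ^ c₂ + c₂ :=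
    IsPBounded.add_holds (IsPBounded.pow_holds h1 c₂) (IsPBounded.const c₂)
  have hm1 : IsPBounded fun N : ℕ => (N ^ c₁ + c₁ + N) ^ c₂ + c₂ + 1 :=
    IsPBounded.add_holds hm (IsPBounded.const 1)
  exact IsPBounded.add_holds (IsPBounded.mul_holds (IsPBounded.mul_holds hm1 hm) hm1) hm

/-- **Composition** (the glue of the line, kernel-checked): degree normal form at budget `N`,
small constants at budget `N₂ = N^c₁ + c₁ + N`, growth lemma with `R = D = M = N₂^c₂ + c₂`;
`bound_isPBounded` turns `(M+1)·M·(M+1) + M` into one exponent `c`. Concludes the crux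
`Summit.ValiantsHypothesis.ValiantsHypothesis.Theses.NumTame.TameNF` BY NAME. [folklore] -/
theorem TameNF_of :
    Registered.stub_degreeNF → Registered.stub_smallConstants → Registered.stub_growth →
      TameNF := by
  rintro ⟨c₁, h₁⟩ ⟨c₂, h₂⟩ h₃
  obtain ⟨c, hc⟩ := bound_isPBounded c₁ c₂
  refine ⟨c, ?_⟩
  intro n t f hcoeff P hfan hcomp
  -- the budget of the crux
  obtain ⟨N, hN⟩ : ∃ N : ℕ, N = P.size + n + t + f.totalDegree := ⟨_, rfl⟩
  have hsN : P.size ≤ N := by omega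
  have hnN : n ≤ N := by omega
  have htN : t ≤ N := by omega
  have hdN : f.totalDegree ≤ N := by omega
  -- step 1: degree normal form at budget N
  obtain ⟨P₁, hP₁f, hP₁fan, hP₁size, hP₁deg⟩ := h₁ n N f P hfan hcomp hsN hdN
  -- step 2: small constants at budget N₂ = N ^ c₁ + c₁ + N
  obtain ⟨N₂, hN₂⟩ : ∃ N₂ : ℕ, N₂ = N ^ c₁ + c₁ + N := ⟨_, rfl⟩
  have hNN₂ : N ≤ N₂ := by rw [hN₂]; exact Nat.le_add_left _ _
  have hMN₂ : N ^ c₁ + c₁ ≤ N₂ := by rw [hN₂]; exact Nat.le_add_right _ _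
  have hcoeff₂ : ∀ m, ‖MvPolynomial.coeff m f‖ ≤ (2 : ℝ) ^ N₂ := fun m =>
    (hcoeff m).trans (pow_le_pow_right₀ (by norm_num) (htN.trans hNN₂))
  obtain ⟨P₂, hP₂f, hP₂fan, hP₂size, hP₂fanIn, hP₂deg, hP₂const, hP₂wt, hP₂out⟩ :=
    h₂ n N₂ f P₁ hcoeff₂ hP₁fan hP₁f (hP₁size.trans hMN₂) (hnN.trans hNN₂) (hdN.trans hNN₂)
      (fun d hd => (hP₁deg d hd).trans hMN₂)
  -- step 3: growth with R = D = M := N₂ ^ c₂ + c₂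
  obtain ⟨M, hM⟩ : ∃ M : ℕ, M = N₂ ^ c₂ + c₂ := ⟨_, rfl⟩
  rw [← hM] at hP₂size hP₂deg hP₂const hP₂wt hP₂out
  have hval := h₃ n P₂ M M hP₂fan hP₂fanIn hP₂const hP₂wt hP₂deg
  -- bookkeeping: (M+1)·M·(M+1) + M ≤ N ^ c + c
  have hB : (M + 1) * M * (M + 1) + M ≤ N ^ c + c := by
    have h := hc N
    simp only at h
    rw [← hN₂, ← hM] at h
    exact h
  have hMc : M ≤ N ^ c + c := le_trans (Nat.le_add_left _ _) hB
  have h2M : (2 : ℝ) ^ M ≤ (2 : ℝ) ^ (N ^ c + c) := pow_le_pow_right₀ (by norm_num) hMc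
  rw [← hN]
  refine ⟨P₂, hP₂f, hP₂size.trans hMc, hP₂fan, ?_, ?_, ?_, ?_⟩
  · intro g hg u hu a hua
    exact (hP₂const g hg u hu a hua).trans h2M
  · intro args hargs a ha
    exact (hP₂wt args hargs a ha).trans h2M
  · intro a ha
    exact (hP₂out a ha).trans h2M
  · intro g hg x
    refine (hval g hg x).trans (pow_le_pow_right₀ (by norm_num) ?_)
    calc (M + 1) * M * (P₂.size + 1) ≤ (M + 1) * M * (M + 1) :=
          Nat.mul_le_mul_left _ (Nat.succ_le_succ hP₂size)
      _ ≤ (M + 1) * M * (M + 1) + M := Nat.le_add_right _ _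
      _ ≤ N ^ c + c := hB

/-- Wiring check: the registered stubs feed `TameNF_of` exactly as stated (the inline stub
signatures are the alias statements verbatim), so the skeleton is `TameNF` closed modulo the three
stubs (sorries enter only through them). -/
example : TameNF :=
  TameNF_of stub_degreeNF stub_smallConstants stub_growth

end Summit.ValiantsHypothesis.ValiantsHypothesis.Cruxes.TameNF.Birth
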